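import Summits.AtomisticToContinuum.Crystallization.Theses.PhononSlackCertificates
import Summits.AtomisticToContinuum.Crystallization.Theorems.ReggeStarCoercivityDefectFreeCrystallizesLayeredGluing01

/-!
# Negative knowledge for crux `PhononSlackCertificates.HullBridge` (stmt-AtomisticToContinuum-15147):
# the layered-window conclusion NEEDS exact minimality (standing disprover, cycle 1; supports 15147)

`HullBridge` is `CoerciveTwoShellGap → NearFieldConvexity → LayeredWindows` (`hullBridge_iff`, `Iff.rfl`),
and `LayeredWindows` says that every sequence of Lennard-Jones GROUND STATES satisfies the layered-window
matrix `LayeredWindowsMatrix` (one in-layer spacing `a ∈ [47/50, 1]`, windows of every scale `(R, ε)`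
frequently in `N`; `layeredWindows_iff_matrix`, `Iff.rfl`).  Here:

* `exists_two_template_points` — every box template `l ↦ A (layeredPos a s z l)` (any frame `A`, any Hägg
  word, box heights) has a point of norm `< 2` and a second point of norm `< 3` at distance exactly `a`;
* `not_windowAt_of_sparse` — hence a `10`-separated configuration (a gas; vacuously every configuration
  with `N ≤ 1`, `not_windowAt_of_subsingleton`) has NO `(3, 1/4)`-window at any box spacing;
* `not_matrix_forall` — so "frequently in `N`" in the crux can never be strengthened to "for all `N`";
* `layeredWindows_false_without_groundState` — the matrix with `IsGroundState lennardJones (x N)` REPLACED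
  by `Function.Injective (x N)` is FALSE (witness: the gas `gasSeq`, particle `i` at height `10 i`);
* `hullBridgeWithoutGroundState_iff` — the correspondingly weakened crux holds iff one of the antecedent
  cruxes `CoerciveTwoShellGap` (13956) / `NearFieldConvexity` (13958) is false.

CONSEQUENCE (load-bearing analysis): any proof of `HullBridge` must use `IsGroundState` beyond
distinctness — in the picked line `Sketch` this enters exactly through `stub_badFraction`
(`E(x N) − N e* = o(N)`, `crysEnergyLimit_proof`) and the `1/3`-separation of ground states.
`registry_lemma` is a small arithmetic fact used by the disprover's attack on the line's rigidity atom
(`PrestressSplitKorn.ExactLayeredRigidity`): a registry shift `(σ + 3m) a√3/6` with a box height realises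
the triangular row gap only ideally (`m = 0`, `h² = 2a²/3`).
-/

noncomputable section

open scoped BigOperators Classical
open Filter Topology

namespace Summit.AtomisticToContinuum.Crystallization.Theorems.HullBridge.Negative.WindowsNeedMinimality

open Summit.AtomisticToContinuum.Crystallization.Theses.PhononSlackCertificates
open Summit.AtomisticToContinuum.Crystallization.Theorems.PrestressSplitKorn
open Literature.MathematicalPhysics.StatisticalMechanics Literature.Geometry.DiscreteGeometry

/-! ## §0 Normal form of the crux -/

/-- `HullBridge` is, definitionally, `CoerciveTwoShellGap → NearFieldConvexity → LayeredWindows`. -/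
theorem hullBridge_iff :
    HullBridge ↔ (CoerciveTwoShellGap → NearFieldConvexity → LayeredWindows) := Iff.rfl

/-! ## §1 Box templates always show two close points near the origin -/

/-- A box height function takes a value in `[0, 17/20]`. -/
theorem exists_height_small {a : ℝ} {z : ℤ → ℝ} (h : InBox a z) :
    ∃ m : ℤ, 0 ≤ z m ∧ z m ≤ 17 / 20 := by
  have ha : 47 / 50 ≤ a := h.1
  have ha1 : a ≤ 1 := h.2.1
  have hc : 0 < 39 / 50 * a := by linarith
  have hmono : StrictMono z := strictMono_int_of_lt_succ fun m => by linarith [(h.2.2 m).1]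
  -- a nonnegative value far up
  obtain ⟨n₂, hn₂⟩ := exists_nat_gt (-z 0 / (39 / 50 * a))
  have hpos : 0 ≤ z (n₂ : ℤ) := by
    have h1 := (h.le_z_natCast n₂).1
    have : -z 0 < 39 / 50 * a * n₂ := by
      rw [div_lt_iff₀ hc] at hn₂; linarith
    linarith
  -- a negative value far down
  obtain ⟨n₁, hn₁⟩ := exists_nat_gt (z 0 / (39 / 50 * a))
  have hneg : z (-(n₁ : ℤ)) < 0 := by
    have h1 := (h.le_z_neg_natCast n₁).1
    have : z 0 < 39 / 50 * a * n₁ := by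
      rw [div_lt_iff₀ hc] at hn₁; linarith
    linarith
  -- least nonnegative layer
  obtain ⟨m₀, hm₀, hmin⟩ := Int.exists_least_of_bdd (P := fun m => 0 ≤ z m)
    ⟨-(n₁ : ℤ), fun m hm => by
      by_contra hlt
      push Not at hlt
      have := hmono hlt
      linarith⟩ ⟨(n₂ : ℤ), hpos⟩
  have hprev : z (m₀ - 1) < 0 := by
    by_contra hge
    push Not at hge
    have := hmin _ hge
    omega
  have hstep := (h.2.2 (m₀ - 1)).2
  rw [sub_add_cancel] at hstep
  exact ⟨m₀, hm₀, by nlinarith⟩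

/-- `u + v = 3 w` for the layer generators and the hole offset. -/
theorem triangularVec_add (a : ℝ) :
    triangularVec₁ a + triangularVec₂ a = (3 : ℝ) • barlowOffset a := by
  ext i; fin_cases i <;> simp [triangularVec₁, triangularVec₂, barlowOffset] <;> ring

/-- `‖u‖ = a`. -/
theorem norm_triangularVec₁ {a : ℝ} (ha : 0 ≤ a) : ‖triangularVec₁ a‖ = a := by
  have h' : ‖triangularVec₁ a‖ ^ 2 = a ^ 2 := by
    rw [EuclideanSpace.norm_sq_eq, Fin.sum_univ_three, Real.norm_eq_abs, Real.norm_eq_abs,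
      Real.norm_eq_abs, sq_abs, sq_abs, sq_abs]
    simp [triangularVec₁]
  nlinarith [norm_nonneg (triangularVec₁ a), sq_nonneg (‖triangularVec₁ a‖ - a),
    sq_nonneg (‖triangularVec₁ a‖ + a)]

/-- **Two close template points near the origin.** Every box template `l ↦ A (layeredPos a s z l)`
(any linear isometry `A`, any word `s`, no translation) has a point of norm `< 2` and a second point of
norm `< 3` at distance exactly `a` from it. -/
theorem exists_two_template_points {a : ℝ} {z : ℤ → ℝ} (h : InBox a z) (s : ℤ → ℤ)
    (A : EuclideanSpace ℝ (Fin 3) →ₗᵢ[ℝ] EuclideanSpace ℝ (Fin 3)) :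
    ∃ l l' : ℤ × ℤ × ℤ, ‖A (layeredPos a s z l)‖ < 2 ∧ ‖A (layeredPos a s z l')‖ < 3 ∧
      dist (A (layeredPos a s z l)) (A (layeredPos a s z l')) = a := by
  have ha : 47 / 50 ≤ a := h.1
  have ha1 : a ≤ 1 := h.2.1
  obtain ⟨m, hm0, hm1⟩ := exists_height_small h
  set L : ℤ := haggLabel s m with hL
  set k : ℤ := L / 3 with hk
  set r : ℤ := L % 3 with hr
  have hLkr : L = 3 * k + r := by rw [hk, hr]; omega
  have hr0 : 0 ≤ r := Int.emod_nonneg _ (by norm_num)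
  have hr3 : r < 3 := Int.emod_lt_of_pos _ (by norm_num)
  have hr2 : (r : ℝ) ≤ 2 := by exact_mod_cast (by omega : r ≤ 2)
  have hr0' : (0 : ℝ) ≤ r := by exact_mod_cast hr0
  -- the planar reduction: layer `m`, indices `(-k, -k)` gives `r • w + z m • e₃`
  have hq : layeredPos a s z (m, -k, -k) = (r : ℝ) • barlowOffset a + z m • layerNormal 1 := by
    have hLr : (haggLabel s m : ℝ) = 3 * (k : ℝ) + (r : ℝ) := by
      rw [← hL, hLkr]; push_cast; ring
    simp only [layeredPos, hLr]
    have huv := triangularVec_add a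
    push_cast
    rw [show (3 * (k : ℝ) + r) • barlowOffset a = (k : ℝ) • ((3 : ℝ) • barlowOffset a) + (r : ℝ) • barlowOffset a
      by module, ← huv]
    module
  have hq' : layeredPos a s z (m, -k + 1, -k) =
      ((r : ℝ) • barlowOffset a + z m • layerNormal 1) + triangularVec₁ a := by
    have : layeredPos a s z (m, -k + 1, -k) = layeredPos a s z (m, -k, -k) + triangularVec₁ a := by
      simp only [layeredPos]; push_cast; module
    rw [this, hq]
  -- norms
  have h3 : (√3 : ℝ) ^ 2 = 3 := Real.sq_sqrt (by norm_num)
  have hnq : ‖(r : ℝ) • barlowOffset a + z m • layerNormal 1‖ < 2 := by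
    set q : EuclideanSpace ℝ (Fin 3) := (r : ℝ) • barlowOffset a + z m • layerNormal 1 with hqdef
    suffices hsq : ‖q‖ ^ 2 < 4 by nlinarith [norm_nonneg q]
    have hns : ‖q‖ ^ 2 = q 0 ^ 2 + q 1 ^ 2 + q 2 ^ 2 := by
      rw [EuclideanSpace.norm_sq_eq, Fin.sum_univ_three, Real.norm_eq_abs, Real.norm_eq_abs,
        Real.norm_eq_abs, sq_abs, sq_abs, sq_abs]
    rw [hns, hqdef]
    simp [barlowOffset, layerNormal]
    have hr2sq : (r : ℝ) ^ 2 ≤ 4 := by nlinarith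
    have ha2 : a ^ 2 ≤ 1 := by nlinarith
    have hz2 : z m ^ 2 ≤ (17 / 20) ^ 2 := by nlinarith
    nlinarith [h3, mul_nonneg (sq_nonneg (r : ℝ)) (sq_nonneg a)]
  refine ⟨(m, -k, -k), (m, -k + 1, -k), ?_, ?_, ?_⟩
  · rw [LinearIsometry.norm_map, hq]; exact hnq
  · rw [LinearIsometry.norm_map, hq']
    calc ‖(r : ℝ) • barlowOffset a + z m • layerNormal 1 + triangularVec₁ a‖
        ≤ ‖(r : ℝ) • barlowOffset a + z m • layerNormal 1‖ + ‖triangularVec₁ a‖ := norm_add_le _ _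
      _ < 2 + 1 := by
          rw [norm_triangularVec₁ (by linarith)]
          linarith
      _ = 3 := by norm_num
  · rw [LinearIsometry.dist_map, hq, hq', dist_eq_norm, sub_add_cancel_left, norm_neg,
      norm_triangularVec₁ (by linarith)]

/-! ## §2 The window predicate of the conclusion and its matrix -/

/-- The `(R, ε)`-window clause of `LayeredWindows` / `HullBridge` for ONE finite configuration `y` at
in-layer spacing `a` (verbatim text of the Theses decl: rigid motion `(A, t)`, Hägg word `s`, box heights `z`). -/
def WindowAt {N : ℕ} (a R ε : ℝ) (y : Fin N → EuclideanSpace ℝ (Fin 3)) : Prop :=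
  ∃ (A : EuclideanSpace ℝ (Fin 3) →ₗᵢ[ℝ] EuclideanSpace ℝ (Fin 3)) (t : EuclideanSpace ℝ (Fin 3)) (s : ℤ → ℤ) (z : ℤ → ℝ), Literature.MathematicalPhysics.StatisticalMechanics.IsHaggSeq s ∧ (∀ m : ℤ, 39 / 50 * a ≤ z (m + 1) - z m ∧ z (m + 1) - z m ≤ 17 / 20 * a) ∧ let S : Set (EuclideanSpace ℝ (Fin 3)) := {p | ∃ m i j : ℤ, p = A (((i : ℝ) • Literature.MathematicalPhysics.StatisticalMechanics.triangularVec₁ a) + ((j : ℝ) • Literature.MathematicalPhysics.StatisticalMechanics.triangularVec₂ a) + ((Literature.MathematicalPhysics.StatisticalMechanics.haggLabel s m : ℝ) • Literature.MathematicalPhysics.StatisticalMechanics.barlowOffset a) + (z m • Literature.MathematicalPhysics.StatisticalMechanics.layerNormal 1))}; (∀ p ∈ S, ‖p‖ ≤ R → ∃ i : Fin N, dist (y i + t) p ≤ ε) ∧ (∀ i : Fin N, ‖y i + t‖ ≤ R → ∃ p ∈ S, dist (y i + t) p ≤ ε)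

/-- The conclusion ("matrix") of `HullBridge` / `LayeredWindows` for ONE sequence `x`: one in-layer
spacing `a ∈ [47/50, 1]` serving windows of every scale frequently in `N`. -/
def LayeredWindowsMatrix (x : (N : ℕ) → (Fin N → EuclideanSpace ℝ (Fin 3))) : Prop :=
  ∃ a : ℝ, 47 / 50 ≤ a ∧ a ≤ 1 ∧ ∀ R ε : ℝ, 0 < ε → ∃ᶠ N in Filter.atTop, WindowAt a R ε (x N)

/-- `LayeredWindows` is "every ground-state sequence satisfies the matrix" (definitional). -/
theorem layeredWindows_iff_matrix :
    LayeredWindows ↔ ∀ x : (N : ℕ) → (Fin N → EuclideanSpace ℝ (Fin 3)),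
      (∀ N, IsGroundState lennardJones (x N)) → LayeredWindowsMatrix x := Iff.rfl

/-- Hence the crux reads `CoerciveTwoShellGap → NearFieldConvexity → ∀ x, ground states → matrix`. -/
theorem hullBridge_iff_matrix :
    HullBridge ↔ (CoerciveTwoShellGap → NearFieldConvexity → ∀ x : (N : ℕ) → (Fin N → EuclideanSpace ℝ (Fin 3)),
      (∀ N, IsGroundState lennardJones (x N)) → LayeredWindowsMatrix x) := Iff.rfl

/-! ## §3 LOAD-BEARING: sparse configurations (in particular `N ≤ 1`) have no window

Any proof of the crux must use `IsGroundState` beyond distinctness of the particles: the matrix fails for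
every sequence of `10`-separated configurations (a "gas"), at the single scale `(R, ε) = (3, 1/4)`. -/

/-- **No window in a gas.** If the particles of `y` are pairwise `≥ 10` apart (vacuous for `N ≤ 1`), then
`y` has no `(3, 1/4)`-window at any box spacing `a ∈ [47/50, 1]`: the template shows two points `p, p'` in
the `3`-ball at distance `a ∈ [47/50, 1]`, which would have to be `1/4`-close to particles — the same
particle (then `a ≤ 1/2`) or two particles `≤ 3/2` apart. -/
theorem not_windowAt_of_sparse {N : ℕ} {y : Fin N → EuclideanSpace ℝ (Fin 3)} (hy : ∀ i j : Fin N, i ≠ j → 10 ≤ dist (y i) (y j))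
    {a : ℝ} (ha : 47 / 50 ≤ a) (ha1 : a ≤ 1) : ¬ WindowAt a 3 (1 / 4) y := by
  rintro ⟨A, t, s, z, -, hz, hW, -⟩
  have hbox : InBox a z := ⟨ha, ha1, hz⟩
  obtain ⟨l, l', hl, hl', hd⟩ := exists_two_template_points hbox s A
  have hmem : ∀ l₀ : ℤ × ℤ × ℤ, A (layeredPos a s z l₀) ∈ {p : EuclideanSpace ℝ (Fin 3) | ∃ m i j : ℤ, p = A (((i : ℝ) • triangularVec₁ a) +
      ((j : ℝ) • triangularVec₂ a) + ((haggLabel s m : ℝ) • barlowOffset a) + (z m • layerNormal 1))} :=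
    fun l₀ => ⟨l₀.1, l₀.2.1, l₀.2.2, rfl⟩
  obtain ⟨i, hi⟩ := hW _ (hmem l) (by linarith)
  obtain ⟨i', hi'⟩ := hW _ (hmem l') hl'.le
  by_cases hii : i = i'
  · subst hii
    have : dist (A (layeredPos a s z l)) (A (layeredPos a s z l')) ≤ 1 / 4 + 1 / 4 := by
      calc dist (A (layeredPos a s z l)) (A (layeredPos a s z l'))
          ≤ dist (A (layeredPos a s z l)) (y i + t) + dist (y i + t) (A (layeredPos a s z l')) := dist_triangle _ _ _
        _ ≤ 1 / 4 + 1 / 4 := by rw [dist_comm] at hi; exact add_le_add hi hi'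
    linarith
  · have h10 := hy i i' hii
    have : dist (y i) (y i') ≤ 1 / 4 + a + 1 / 4 := by
      have e1 : dist (y i) (y i') = dist (y i + t) (y i' + t) := by simp [dist_eq_norm]
      rw [e1]
      calc dist (y i + t) (y i' + t)
          ≤ dist (y i + t) (A (layeredPos a s z l)) + dist (A (layeredPos a s z l)) (y i' + t) := dist_triangle _ _ _
        _ ≤ dist (y i + t) (A (layeredPos a s z l)) +
            (dist (A (layeredPos a s z l)) (A (layeredPos a s z l')) + dist (A (layeredPos a s z l')) (y i' + t)) :=
            by gcongr; exact dist_triangle _ _ _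
        _ ≤ 1 / 4 + (a + 1 / 4) := by rw [hd, dist_comm (A _) (y i' + t)]; gcongr
        _ = 1 / 4 + a + 1 / 4 := by ring
    linarith

/-- **Small model `N ≤ 1`**: the empty and the one-particle configuration have no `(3, 1/4)`-window.  So the
window clause is false for `N = 0, 1` whatever the sequence: "frequently in `N`" in the crux cannot be
strengthened to "for all `N`", and a prover must produce windows at LARGE `N`. -/
theorem not_windowAt_of_subsingleton {N : ℕ} (hN : N ≤ 1) (y : Fin N → EuclideanSpace ℝ (Fin 3)) {a : ℝ} (ha : 47 / 50 ≤ a)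
    (ha1 : a ≤ 1) : ¬ WindowAt a 3 (1 / 4) y :=
  not_windowAt_of_sparse (fun i j hij => absurd (Fin.ext (by omega)) hij) ha ha1

/-- The natural strengthening "windows for ALL `N`" of the matrix is false for EVERY sequence. -/
theorem not_matrix_forall (x : (N : ℕ) → (Fin N → EuclideanSpace ℝ (Fin 3))) :
    ¬ ∃ a : ℝ, 47 / 50 ≤ a ∧ a ≤ 1 ∧ ∀ R ε : ℝ, 0 < ε → ∀ N, WindowAt a R ε (x N) := by
  rintro ⟨a, ha, ha1, h⟩
  exact not_windowAt_of_subsingleton (le_refl 1) (x 1) ha ha1 (h 3 (1 / 4) (by norm_num) 1)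

/-- The gas sequence: particle `i` at height `10 i` on the vertical axis. -/
def gasSeq (N : ℕ) (i : Fin N) : EuclideanSpace ℝ (Fin 3) := ((10 * (i : ℕ) : ℕ) : ℝ) • layerNormal 1

/-- The gas is `10`-separated. -/
theorem gasSeq_sparse (N : ℕ) : ∀ i j : Fin N, i ≠ j → 10 ≤ dist (gasSeq N i) (gasSeq N j) := by
  intro i j hij
  have hne : (i : ℕ) ≠ j := fun h => hij (Fin.ext h)
  have hn1 : ‖(layerNormal 1 : EuclideanSpace ℝ (Fin 3))‖ = 1 := by
    have h : ‖(layerNormal 1 : EuclideanSpace ℝ (Fin 3))‖ ^ 2 = 1 := by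
      rw [EuclideanSpace.norm_sq_eq, Fin.sum_univ_three, Real.norm_eq_abs, Real.norm_eq_abs,
        Real.norm_eq_abs, sq_abs, sq_abs, sq_abs]
      simp [layerNormal]
    nlinarith [norm_nonneg (layerNormal 1 : EuclideanSpace ℝ (Fin 3))]
  rw [gasSeq, gasSeq, dist_eq_norm, ← sub_smul, norm_smul, hn1, mul_one, Real.norm_eq_abs]
  push_cast
  rcases Nat.lt_or_gt_of_ne hne with hlt | hlt
  · have h1 : (i : ℝ) + 1 ≤ j := by exact_mod_cast hlt
    rw [abs_of_nonpos (by linarith)]; linarith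
  · have h1 : (j : ℝ) + 1 ≤ i := by exact_mod_cast hlt
    rw [abs_of_nonneg (by linarith)]; linarith

/-- The gas consists of distinct particles. -/
theorem gasSeq_injective (N : ℕ) : Function.Injective (gasSeq N) := by
  intro i j h
  by_contra hij
  have := gasSeq_sparse N i j hij
  rw [h, dist_self] at this
  linarith

/-- **The matrix fails for the gas.** -/
theorem not_matrix_gasSeq : ¬ LayeredWindowsMatrix gasSeq := by
  rintro ⟨a, ha, ha1, h⟩
  obtain ⟨N, hN⟩ := (h 3 (1 / 4) (by norm_num)).exists
  exact not_windowAt_of_sparse (gasSeq_sparse N) ha ha1 hN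

/-- `LayeredWindows` with `IsGroundState lennardJones (x N)` REPLACED by `Function.Injective (x N)`
(everything else verbatim). -/
def LayeredWindowsWithoutGroundState : Prop :=
  ∀ x : (N : ℕ) → (Fin N → EuclideanSpace ℝ (Fin 3)), (∀ N, Function.Injective (x N)) → LayeredWindowsMatrix x

/-- **Load-bearing hypothesis.** Without exact minimality the conclusion of the crux is false
(witness: the gas).  So `HullBridge` cannot be proved by an argument blind to `IsGroundState`, unless that
argument REFUTES one of the two antecedent cruxes (see `hullBridgeWithoutGroundState_iff`). -/
theorem layeredWindows_false_without_groundState : ¬ LayeredWindowsWithoutGroundState :=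
  fun h => not_matrix_gasSeq (h gasSeq gasSeq_injective)

/-- `HullBridge` with the ground-state hypothesis of its conclusion weakened to injectivity. -/
def HullBridgeWithoutGroundState : Prop :=
  CoerciveTwoShellGap → NearFieldConvexity → LayeredWindowsWithoutGroundState

/-- … which holds IFF one of the two antecedent cruxes (13956 `CoerciveTwoShellGap`, 13958
`NearFieldConvexity`) is false: the weakened crux is exactly as hard as refuting the route's engine. -/
theorem hullBridgeWithoutGroundState_iff :
    HullBridgeWithoutGroundState ↔ ¬ (CoerciveTwoShellGap ∧ NearFieldConvexity) := by
  constructor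
  · rintro h ⟨h1, h2⟩
    exact layeredWindows_false_without_groundState (h h1 h2)
  · intro h h1 h2
    exact absurd ⟨h1, h2⟩ h

/-! ## §4 A small arithmetic fact about box registries -/

/-- **Registry lemma** (arithmetic core of "bi-layered ⇒ ideal fcc"): a lateral registry shift
`(σ + 3m)·a·√3/6` (`σ = ±1`) and a box height `h ∈ [39a/50, 17a/20]` realise the triangular row gap
`a√3/2` only for `m = 0` and the ideal height `h² = 2a²/3`. [folklore] -/
theorem registry_lemma {a h σ : ℝ} {m : ℤ} (ha : 47 / 50 ≤ a)
    (hh : 39 / 50 * a ≤ h) (hh1 : h ≤ 17 / 20 * a) (hσ : σ = 1 ∨ σ = -1)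
    (hgap : ((σ + 3 * m) * a * √3 / 6) ^ 2 + h ^ 2 = (a * √3 / 2) ^ 2) :
    m = 0 ∧ h ^ 2 = 2 / 3 * a ^ 2 := by
  have h3 : (√3 : ℝ) ^ 2 = 3 := Real.sq_sqrt (by norm_num)
  have ha0 : 0 < a := by linarith
  -- normalise: (σ + 3m)² a² / 12 + h² = 3 a² / 4
  have key : (σ + 3 * m) ^ 2 * a ^ 2 / 12 + h ^ 2 = 3 * a ^ 2 / 4 := by
    have e1 : ((σ + 3 * m) * a * √3 / 6) ^ 2 = (σ + 3 * m) ^ 2 * a ^ 2 * (√3) ^ 2 / 36 := by ring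
    have e2 : (a * √3 / 2) ^ 2 = a ^ 2 * (√3) ^ 2 / 4 := by ring
    rw [e1, e2, h3] at hgap
    linarith
  -- (σ+3m)² ∈ (0.3, 1.7) hence = 1
  have hq_lo : (σ + 3 * m) ^ 2 * a ^ 2 < 2 * a ^ 2 := by nlinarith
  have hq_hi : 0 < (σ + 3 * m) ^ 2 * a ^ 2 := by nlinarith
  have ha2 : 0 < a ^ 2 := by positivity
  have hq1 : (σ + 3 * m) ^ 2 < 2 := by
    by_contra hc; push Not at hc; nlinarith
  have hm : m = 0 := by
    rcases hσ with rfl | rfl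
    · have : ((1 + 3 * m : ℤ) : ℝ) ^ 2 < 2 := by push_cast; exact hq1
      have hi : (1 + 3 * m) ^ 2 < 2 := by exact_mod_cast this
      nlinarith
    · have : ((-1 + 3 * m : ℤ) : ℝ) ^ 2 < 2 := by push_cast; exact hq1
      have hi : (-1 + 3 * m) ^ 2 < 2 := by exact_mod_cast this
      nlinarith
  subst hm
  have hs : (σ + 3 * ((0 : ℤ) : ℝ)) ^ 2 = 1 := by
    rcases hσ with rfl | rfl <;> norm_num
  rw [hs] at key
  exact ⟨rfl, by linarith⟩


end Summit.AtomisticToContinuum.Crystallization.Theorems.HullBridge.Negative.WindowsNeedMinimality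

end
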